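import Summits.HodgeConjecture.HodgeConjecture.Theorems.F0P3bCochainValues
import Literature.NumberTheory.Automorphic.GKModules
import HarnessLib

/-!
# FLOOR-0 P3b «ENGINE local packets», line `F0_EngineLocalPackets` — STUB T6b CLOSED: each degree-one Hodge piece
# `H¹_δ` of an irreducible `(𝔤, K)`-module of `U(2,1)` is at most a complex line (no unitarity, no classification)

Cell hodgecm-mathlib (D-0151), FLOOR 0, crux item H413 = stmt-HodgeConjecture-24833; sub-line
`Cruxes/H413/Lines/F0_EngineLocalPackets.lean` (F0P3b-plan, ed. 1 808dda7d), registered stub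
`stub_T6b_degOneTypeFinrank : StubT6bDegOneTypeFinrank` (§2 there).  PROOF lane (theorems only); author F0P3-p01 (g2).
As for T6a (`F0P3bStubT6aDegOneTypePure`): the Lines-local bundle `(h : IsCohUnitaryIrrep ρK ρ𝔤)` of the stub body is
replaced by its two used fields, `(hGK : IsGKModule _ ρK ρ𝔤) (hirr : IsIrreducibleGK ρK ρ𝔤)`; the edition-2 fold is
`theorem stub_T6b_degOneTypeFinrank : StubT6bDegOneTypeFinrank := fun V _ _ ρK ρ𝔤 h => stubT6b_holds V ρK ρ𝔤 h.gk h.irred`.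

THE PROOF ([BorelWallach2000, II §4.1–4.2, VI 4.11 (3)]; [Rogawski1990, §15.2]).  Off `δ = ±1` the type is empty
(★ `upq_eq_zero_of_mem_type`).  For `δ = ±1`, `μ = δ i`: a closed type-`δ` cochain `f` kills `𝔨`, satisfies
`f(JY) = μ f(Y)`, `f(⁅W, Y⁆) = ρW f(Y)` (`W ∈ 𝔨`), `f(Ad k Y) = ρK k f(Y)`, so the span `E_f` of its two values
`u_p = f(X_{E_p})` (`p ∈ Fin 2 × Fin 1`) is a null core (★ T3j) of weight `μ`; if `f ≠ 0`, irreducibility gives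
`eigenspace(ρz₀, μ) = E_f` (★ `eigenspace_eq_of_isNullCore`).  For a second closed type-`δ` cochain `g` the values
`v_p = g(X_{E_p})` lie in `E_f = ℂu₀ + ℂu₁`; the torus element `h₁ = iE₁₁ ∈ 𝔨` (`[h₁, X_{E_0}] = 0`, `[h₁, X_{E_1}] = J X_{E_1}`)
forces `v₁ ∈ ℂ u₁`, say `v₁ = c u₁`, and the rotation `w = E₀₁ − E₁₀ ∈ 𝔨` (`[w, X_{E_1}] = X_{E_0}`) gives `v₀ = c u₀`; hence
`g = c f`, the cocycles of type `δ` form the complex line `ℂ f`, and `finrank_ℝ H¹_δ ≤ 2`.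

HONEST LABEL: HC_CM is proved only modulo the printed citations until rung 0 closes; this file discharges none of them.
-/

-- Mathlib idiom (as in `GKModules`, `GKCohomology`, the `Upq*` files and the Lines file): commutator bracket on `Module.End`
attribute [local instance 100] LieRing.ofAssociativeRing

set_option autoImplicit false
set_option linter.dupNamespace false

noncomputable section

namespace Summit.HodgeConjecture.HodgeConjecture.Cruxes.H413.F0P3bStubT6bDegOneTypeFinrank

open scoped Matrix
open Literature.Algebra.Lie Literature.Algebra.Lie.ChevalleyEilenberg
open Literature.NumberTheory.Automorphic
open Literature.RepresentationTheory.BorelWallach2000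
open Literature.RepresentationTheory.KonnoKonno2007 Literature.RepresentationTheory.KonnoKonno2007.RealDualPair
open Literature.RepresentationTheory.KonnoKonno2007.RealDualPair.UForm
open Summit.HodgeConjecture.HodgeConjecture.Cruxes.H413.F0P3bPPartOperators
open Summit.HodgeConjecture.HodgeConjecture.Cruxes.H413.F0P3bPNullGeneration
open Summit.HodgeConjecture.HodgeConjecture.Cruxes.H413.F0P3bPNullIrreducible
open Summit.HodgeConjecture.HodgeConjecture.Cruxes.H413.F0P3bCochainValues

/-! ## §2 Block-diagonal elements of `𝔨` and the two `U(2) × U(1)` test elements `h₁ = iE₁₁`, `w = E₀₁ − E₁₀` -/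

section KElements

variable {α β : Type} [Fintype α] [DecidableEq α] [Fintype β] [DecidableEq β]

/-- `k_A = [[A, 0], [0, 0]] ∈ 𝔲(α, β)` for skew-hermitian `A`. [cite: BorelWallach2000, II §1.1 (3)] -/
theorem blockDiag_mem_lie (A : Matrix α α ℂ) (hA : Aᴴ = -A) :
    Matrix.fromBlocks A 0 0 (0 : Matrix β β ℂ) ∈ (uFormGroup α β).lie :=
  (upq_fromBlocks_mem_lie_iff A 0 0 0).2 ⟨hA, by simp, by simp⟩

/-- `k_A ∈ 𝔨`. [cite: BorelWallach2000, II §1.1 (3)] -/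
theorem blockDiag_mem_kInLie (A : Matrix α α ℂ) (hA : Aᴴ = -A) :
    (⟨Matrix.fromBlocks A 0 0 0, blockDiag_mem_lie A hA⟩ : (uFormGroup α β).lie) ∈ (uFormGroup α β).kInLie :=
  (upq_mem_kInLie_iff_blocks _).2 (by simp)

/-- **`⁅k_A, X_{cE_p}⁆ = X_{A · cE_p}`**: the block-diagonal `𝔨` acts on `𝔭 ≅ M_{α×β}(ℂ)` by left multiplication.
[cite: BorelWallach2000, II §1.1 (3)] -/
theorem lie_blockDiag_upqUnit (A : Matrix α α ℂ) (hA : Aᴴ = -A) (p : α × β) (c : ℂ) :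
    ⁅(⟨Matrix.fromBlocks A 0 0 0, blockDiag_mem_lie A hA⟩ : (uFormGroup α β).lie), upqUnit p c⁆ =
      ⟨Matrix.fromBlocks 0 (A * Matrix.single p.1 p.2 c) (A * Matrix.single p.1 p.2 c)ᴴ 0, upq_offDiag_mem_lie _⟩ := by
  apply Subtype.ext
  rw [LieSubalgebra.coe_bracket, Ring.lie_def, coe_upqUnit]
  change Matrix.fromBlocks A 0 0 0 * Matrix.fromBlocks 0 (Matrix.single p.1 p.2 c) (Matrix.single p.1 p.2 c)ᴴ 0 -
      Matrix.fromBlocks 0 (Matrix.single p.1 p.2 c) (Matrix.single p.1 p.2 c)ᴴ 0 * Matrix.fromBlocks A 0 0 0 =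
    Matrix.fromBlocks 0 (A * Matrix.single p.1 p.2 c) (A * Matrix.single p.1 p.2 c)ᴴ 0
  rw [Matrix.fromBlocks_multiply, Matrix.fromBlocks_multiply, sub_eq_add_neg, Matrix.fromBlocks_neg, Matrix.fromBlocks_add,
    Matrix.conjTranspose_mul, hA]
  simp

/-- **The torus element `h₁ = iE₁₁ ∈ 𝔨` of `U(2,1)`**: `⁅h₁, X_{cE_{00}}⁆ = 0`, `⁅h₁, X_{cE_{10}}⁆ = X_{icE_{10}} = J X_{cE_{10}}`.
[cite: BorelWallach2000, VI 4.11 (3)] -/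
theorem exists_torus_u21 : ∃ H ∈ (uFormGroup (Fin 2) (Fin 1)).kInLie,
    (∀ c : ℂ, ⁅H, upqUnit ((0 : Fin 2), (0 : Fin 1)) c⁆ = 0) ∧
    (∀ c : ℂ, ⁅H, upqUnit ((1 : Fin 2), (0 : Fin 1)) c⁆ = upqUnit ((1 : Fin 2), (0 : Fin 1)) (Complex.I * c)) := by
  have hA : (Complex.I • Matrix.single (1 : Fin 2) (1 : Fin 2) (1 : ℂ))ᴴ =
      -(Complex.I • Matrix.single (1 : Fin 2) (1 : Fin 2) (1 : ℂ)) := by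
    rw [Matrix.conjTranspose_smul, Matrix.conjTranspose_single, star_one, Complex.star_def, Complex.conj_I, neg_smul]
  refine ⟨⟨Matrix.fromBlocks (Complex.I • Matrix.single (1 : Fin 2) (1 : Fin 2) (1 : ℂ)) 0 0 0, blockDiag_mem_lie _ hA⟩,
    blockDiag_mem_kInLie _ hA, fun c => ?_, fun c => ?_⟩
  · rw [lie_blockDiag_upqUnit _ hA]
    apply Subtype.ext
    simp
  · rw [lie_blockDiag_upqUnit _ hA]
    apply Subtype.ext
    simp [Matrix.smul_single, coe_upqUnit]

/-- **The rotation `w = E₀₁ − E₁₀ ∈ 𝔨` of `U(2,1)`**: `⁅w, X_{cE_{10}}⁆ = X_{cE_{00}}`, `⁅w, X_{cE_{00}}⁆ = −X_{cE_{10}}`.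
[cite: BorelWallach2000, VI 4.11 (3)] -/
theorem exists_rotation_u21 : ∃ W ∈ (uFormGroup (Fin 2) (Fin 1)).kInLie,
    (∀ c : ℂ, ⁅W, upqUnit ((1 : Fin 2), (0 : Fin 1)) c⁆ = upqUnit ((0 : Fin 2), (0 : Fin 1)) c) ∧
    (∀ c : ℂ, ⁅W, upqUnit ((0 : Fin 2), (0 : Fin 1)) c⁆ = upqUnit ((1 : Fin 2), (0 : Fin 1)) (-c)) := by
  have hA : (Matrix.single (0 : Fin 2) (1 : Fin 2) (1 : ℂ) - Matrix.single (1 : Fin 2) (0 : Fin 2) (1 : ℂ))ᴴ =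
      -(Matrix.single (0 : Fin 2) (1 : Fin 2) (1 : ℂ) - Matrix.single (1 : Fin 2) (0 : Fin 2) (1 : ℂ)) := by
    rw [Matrix.conjTranspose_sub, Matrix.conjTranspose_single, Matrix.conjTranspose_single, star_one, neg_sub]
  refine ⟨⟨Matrix.fromBlocks (Matrix.single (0 : Fin 2) (1 : Fin 2) (1 : ℂ) - Matrix.single (1 : Fin 2) (0 : Fin 2) (1 : ℂ))
      0 0 0, blockDiag_mem_lie _ hA⟩, blockDiag_mem_kInLie _ hA, fun c => ?_, fun c => ?_⟩
  · rw [lie_blockDiag_upqUnit _ hA]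
    apply Subtype.ext
    simp [Matrix.sub_mul, coe_upqUnit]
  · rw [lie_blockDiag_upqUnit _ hA, ← neg_upqUnit]
    apply Subtype.ext
    rw [NegMemClass.coe_neg, coe_upqUnit, Matrix.fromBlocks_neg]
    simp [Matrix.sub_mul]

end KElements

/-! ## §3 In an irreducible `(𝔤, K)`-module of `U(2,1)` the closed cochains of type `δ` form a complex line -/

section Line

/-- The two matrix-unit directions of `𝔭 ⊂ 𝔲(2,1)`. [folklore] -/
theorem range_fin21 {W : Type} (u : Fin 2 × Fin 1 → W) :
    Set.range u = {u ((0 : Fin 2), (0 : Fin 1)), u ((1 : Fin 2), (0 : Fin 1))} := by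
  ext x
  constructor
  · rintro ⟨⟨a, b⟩, rfl⟩
    fin_cases a <;> fin_cases b <;> simp
  · rintro (rfl | rfl)
    · exact ⟨_, rfl⟩
    · exact ⟨_, rfl⟩

/-- The one-entry vector `![0]` is the zero vector. [folklore] -/
theorem vec_single_zero : (![(0 : (uFormGroup (Fin 2) (Fin 1)).lie)] : Fin 1 → (uFormGroup (Fin 2) (Fin 1)).lie) = 0 := by
  funext i
  fin_cases i
  rfl

variable {V : Type} [AddCommGroup V] [Module ℂ V]
  (ρK : Representation ℂ (uFormGroup (Fin 2) (Fin 1)).maximalCompact V)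
  (ρ𝔤 : (uFormGroup (Fin 2) (Fin 1)).lie →ₗ⁅ℝ⁆ Module.End ℂ V)
  (hV : ∀ (k : (uFormGroup (Fin 2) (Fin 1)).maximalCompact) (X : (uFormGroup (Fin 2) (Fin 1)).lie),
    ρK k ∘ₗ ρ𝔤 X ∘ₗ ρK k⁻¹ =
      ρ𝔤 ((uFormGroup (Fin 2) (Fin 1)).Ad (Subgroup.inclusion (uFormGroup (Fin 2) (Fin 1)).maximalCompact_le_carrier k) X))

include hV in
/-- **`K`-multiplicity one, by hand**: in an irreducible `(𝔤, K)`-module of `U(2,1)`, any closed `(𝔤, K)`-1-cochain `g`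
of type `δ = ±1` is a complex multiple of any non-zero one `f` (torus weight `h₁` on `E_f = ℂu₀ + ℂu₁`, then the rotation
`w`). [cite: BorelWallach2000, VI Thm. 4.11 (3); Rogawski1990, Prop. 15.2.1 (b)] -/
theorem cocycle_eq_smul (hirr : IsIrreducibleGK ρK ρ𝔤) {δ : ℤ} (hδ : δ * δ = 1)
    (f g : Cochain ℝ (uFormGroup (Fin 2) (Fin 1)).lie (GKCarrier (uFormGroup (Fin 2) (Fin 1)) ρ𝔤) 1)
    (hf : f ∈ upqType ρK ρ𝔤 hV 1 δ) (hdf : d ℝ (uFormGroup (Fin 2) (Fin 1)).lie (GKCarrier (uFormGroup (Fin 2) (Fin 1)) ρ𝔤) 1 f = 0)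
    (hf0 : f ≠ 0)
    (hg : g ∈ upqType ρK ρ𝔤 hV 1 δ) (hdg : d ℝ (uFormGroup (Fin 2) (Fin 1)).lie (GKCarrier (uFormGroup (Fin 2) (Fin 1)) ρ𝔤) 1 g = 0) :
    ∃ c : ℂ, g = c • f := by
  have hμ0 : ((δ : ℂ) * Complex.I) ≠ 0 := by
    refine mul_ne_zero ?_ Complex.I_ne_zero
    have hδ0 : δ ≠ 0 := fun h => by rw [h, mul_zero] at hδ; exact zero_ne_one hδ
    exact_mod_cast hδ0
  obtain ⟨hgC, -⟩ := (mem_upqType_iff ρK ρ𝔤 hV 1 δ g).1 hg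
  obtain ⟨hfC, -⟩ := (mem_upqType_iff ρK ρ𝔤 hV 1 δ f).1 hf
  -- `v₁ = g(X_{E_1}) ∈ E_f = ℂ u₀ + ℂ u₁`, `u_p = f(X_{E_p})`
  have hv1 : cval ρ𝔤 g (upqUnit ((1 : Fin 2), (0 : Fin 1)) 1) ∈
      Submodule.span ℂ {cval ρ𝔤 f (upqUnit ((0 : Fin 2), (0 : Fin 1)) 1), cval ρ𝔤 f (upqUnit ((1 : Fin 2), (0 : Fin 1)) 1)} := by
    rw [← range_fin21 (fun p : Fin 2 × Fin 1 => cval ρ𝔤 f (upqUnit p 1))]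
    exact cval_mem_span_of_ne_zero ρK ρ𝔤 hV f hirr hδ hf hdf hf0 g hg _
  obtain ⟨a, b, hab⟩ := Submodule.mem_span_pair.1 hv1
  obtain ⟨H, hH, hH0, hH1⟩ := exists_torus_u21
  obtain ⟨W, hW, hW1, -⟩ := exists_rotation_u21
  -- the torus weights: `H u₀ = 0`, `H u₁ = μ u₁`, `H v₁ = μ v₁`
  have Hu0 : ρ𝔤 H (cval ρ𝔤 f (upqUnit ((0 : Fin 2), (0 : Fin 1)) 1)) = 0 := by
    rw [← cval_lieK ρK ρ𝔤 hV f hf hdf H hH, hH0, cval_def, vec_single_zero]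
    exact AlternatingMap.map_zero f
  have Hu1 : ρ𝔤 H (cval ρ𝔤 f (upqUnit ((1 : Fin 2), (0 : Fin 1)) 1)) =
      ((δ : ℂ) * Complex.I) • cval ρ𝔤 f (upqUnit ((1 : Fin 2), (0 : Fin 1)) 1) := by
    rw [← cval_lieK ρK ρ𝔤 hV f hf hdf H hH, hH1, cval_upqUnit_I ρK ρ𝔤 hV f hf hdf]
  have Hv1 : ρ𝔤 H (cval ρ𝔤 g (upqUnit ((1 : Fin 2), (0 : Fin 1)) 1)) =
      ((δ : ℂ) * Complex.I) • cval ρ𝔤 g (upqUnit ((1 : Fin 2), (0 : Fin 1)) 1) := by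
    rw [← cval_lieK ρK ρ𝔤 hV g hg hdg H hH, hH1, cval_upqUnit_I ρK ρ𝔤 hV g hg hdg]
  -- apply `H` to `a u₀ + b u₁ = v₁`: the `u₀`-component of `v₁` vanishes
  have ha0 : a • cval ρ𝔤 f (upqUnit ((0 : Fin 2), (0 : Fin 1)) 1) = 0 := by
    have e := congrArg (ρ𝔤 H) hab
    rw [map_add, map_smul, map_smul, Hu0, Hu1, Hv1, smul_zero, zero_add, ← hab, smul_add,
      smul_comm b ((δ : ℂ) * Complex.I)] at e
    have e' : ((δ : ℂ) * Complex.I) • a • cval ρ𝔤 f (upqUnit ((0 : Fin 2), (0 : Fin 1)) 1) = 0 := add_eq_right.1 e.symm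
    exact (smul_eq_zero.1 e').resolve_left hμ0
  have hv1' : cval ρ𝔤 g (upqUnit ((1 : Fin 2), (0 : Fin 1)) 1) = b • cval ρ𝔤 f (upqUnit ((1 : Fin 2), (0 : Fin 1)) 1) := by
    rw [← hab, ha0, zero_add]
  -- the rotation transports the ratio to `u₀`
  have hWu : ρ𝔤 W (cval ρ𝔤 f (upqUnit ((1 : Fin 2), (0 : Fin 1)) 1)) = cval ρ𝔤 f (upqUnit ((0 : Fin 2), (0 : Fin 1)) 1) := by
    rw [← cval_lieK ρK ρ𝔤 hV f hf hdf W hW, hW1]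
  have hWv : ρ𝔤 W (cval ρ𝔤 g (upqUnit ((1 : Fin 2), (0 : Fin 1)) 1)) = cval ρ𝔤 g (upqUnit ((0 : Fin 2), (0 : Fin 1)) 1) := by
    rw [← cval_lieK ρK ρ𝔤 hV g hg hdg W hW, hW1]
  have hv0' : cval ρ𝔤 g (upqUnit ((0 : Fin 2), (0 : Fin 1)) 1) = b • cval ρ𝔤 f (upqUnit ((0 : Fin 2), (0 : Fin 1)) 1) := by
    rw [← hWv, hv1', map_smul, hWu]
  have hp : ∀ p : Fin 2 × Fin 1, cval ρ𝔤 g (upqUnit p 1) = b • cval ρ𝔤 f (upqUnit p 1) := by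
    rintro ⟨i, j⟩
    fin_cases i <;> fin_cases j
    · exact hv0'
    · exact hv1'
  -- conclude on a general argument `Y = k + Σ c_s x_s`
  refine ⟨b, eq_smul_of_cval ρ𝔤 f g b fun Y => ?_⟩
  obtain ⟨k, hk, c, rfl⟩ := upq_exists_kInLie_add_sum_upqPBasis Y
  rw [cval_add, cval_add, cval_eq_zero_of_mem_kInLie ρK ρ𝔤 hV g hgC k hk,
    cval_eq_zero_of_mem_kInLie ρK ρ𝔤 hV f hfC k hk, zero_add, zero_add, cval_sum_smul, cval_sum_smul, Finset.smul_sum]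
  refine Finset.sum_congr rfl fun s _ => ?_
  rw [upqPBasis, cval_upqUnit ρK ρ𝔤 hV g hg hdg, cval_upqUnit ρK ρ𝔤 hV f hf hdf, hp s.1, smul_comm b ((c s : ℝ) : ℂ),
    smul_comm b (((upqPCoeff s.2).re : ℂ) + _)]

include hV in
/-- **`H¹_δ` is finite-dimensional of real dimension `≤ 2`** for an irreducible `(𝔤, K)`-module of `U(2,1)` (all `δ`):
the cocycles of type `δ` lie in the real plane `ℝ f ⊕ ℝ if` (or vanish), and `H¹_δ` is their image.
[cite: BorelWallach2000, VI Thm. 4.11 (3); Rogawski1990, Prop. 15.2.1 (b)] -/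
theorem typeClasses_finite_finrank_le_two (hirr : IsIrreducibleGK ρK ρ𝔤) (δ : ℤ) :
    Module.Finite ℝ ↥(upqTypeClasses ρK ρ𝔤 hV 1 δ) ∧ Module.finrank ℝ ↥(upqTypeClasses ρK ρ𝔤 hV 1 δ) ≤ 2 := by
  -- the real space of cocycles of type `δ`, inside the cocycles
  set Zc : Submodule ℝ ↥((gkComplex (uFormGroup (Fin 2) (Fin 1)) ρK ρ𝔤 hV).cocycles 1) :=
    (upqType ρK ρ𝔤 hV 1 δ).comap ((gkComplex (uFormGroup (Fin 2) (Fin 1)) ρK ρ𝔤 hV).cocycles 1).subtype with hZc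
  have hcl : upqTypeClasses ρK ρ𝔤 hV 1 δ = Zc.map ((gkComplex (uFormGroup (Fin 2) (Fin 1)) ρK ρ𝔤 hV).toCohomology 1) := rfl
  suffices hZ : ∃ S : Submodule ℝ ↥((gkComplex (uFormGroup (Fin 2) (Fin 1)) ρK ρ𝔤 hV).cocycles 1),
      Zc ≤ S ∧ Module.Finite ℝ S ∧ Module.finrank ℝ S ≤ 2 by
    obtain ⟨S, hle, hSfin, hS2⟩ := hZ
    haveI : Module.Finite ℝ Zc := Submodule.finiteDimensional_of_le hle
    refine ⟨?_, ?_⟩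
    · rw [hcl]; infer_instance
    · rw [hcl]; exact (Submodule.finrank_map_le _ _).trans ((Submodule.finrank_mono hle).trans hS2)
  by_cases hex : ∃ z ∈ Zc, z ≠ 0
  · obtain ⟨z, hz, hz0⟩ := hex
    set f₀ : Cochain ℝ (uFormGroup (Fin 2) (Fin 1)).lie (GKCarrier (uFormGroup (Fin 2) (Fin 1)) ρ𝔤) 1 := z.1 with hf₀
    have hzt : f₀ ∈ upqType ρK ρ𝔤 hV 1 δ := Submodule.mem_comap.1 hz
    obtain ⟨hzC, hzd⟩ := ((gkComplex (uFormGroup (Fin 2) (Fin 1)) ρK ρ𝔤 hV).mem_cocycles_iff 1 _).1 z.2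
    have hz0' : f₀ ≠ 0 := fun h => hz0 (Subtype.ext h)
    -- `δ = ±1`, otherwise the type is empty
    have hδ : δ * δ = 1 := by
      by_contra hδ
      refine hz0' (upq_eq_zero_of_mem_type ρK ρ𝔤 hV (fun k hk => ?_) _ hzt)
      rcases Nat.le_one_iff_eq_zero_or_eq_one.1 hk with rfl | rfl
      · intro h; apply hδ; rw [h]; norm_num
      · intro h; apply hδ; rw [h]; norm_num
    -- the companion cocycle `i f₀`
    have hzI : Complex.I • f₀ ∈ (gkComplex (uFormGroup (Fin 2) (Fin 1)) ρK ρ𝔤 hV).cocycles 1 :=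
      ((gkComplex (uFormGroup (Fin 2) (Fin 1)) ρK ρ𝔤 hV).mem_cocycles_iff 1 _).2
        ⟨upq_smul_mem_gkComplex ρK ρ𝔤 hV 1 Complex.I f₀ hzC, by rw [d_smul, hzd, smul_zero]⟩
    refine ⟨Submodule.span ℝ (Set.range ![z, ⟨_, hzI⟩]), fun z' hz' => ?_, Module.Finite.span_of_finite ℝ (Set.finite_range _),
      ?_⟩
    · have hz't : (z' : Cochain ℝ (uFormGroup (Fin 2) (Fin 1)).lie (GKCarrier (uFormGroup (Fin 2) (Fin 1)) ρ𝔤) 1) ∈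
          upqType ρK ρ𝔤 hV 1 δ := Submodule.mem_comap.1 hz'
      obtain ⟨-, hz'd⟩ := ((gkComplex (uFormGroup (Fin 2) (Fin 1)) ρK ρ𝔤 hV).mem_cocycles_iff 1 _).1 z'.2
      obtain ⟨c, hc⟩ := cocycle_eq_smul ρK ρ𝔤 hV hirr hδ f₀ _ hzt hzd hz0' hz't hz'd
      have e : z' = c.re • z + c.im • ⟨_, hzI⟩ := by
        apply Subtype.ext
        rw [Submodule.coe_add, Submodule.coe_smul, Submodule.coe_smul, hc, ← hf₀]
        refine AlternatingMap.ext fun v => ?_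
        simp only [AlternatingMap.add_apply, AlternatingMap.smul_apply]
        change c • f₀ v = ((c.re : ℂ)) • f₀ v + ((c.im : ℂ)) • (Complex.I • f₀ v)
        rw [smul_smul, ← add_smul, Complex.re_add_im]
      rw [e]
      exact Submodule.add_mem _ (Submodule.smul_mem _ _ (Submodule.subset_span ⟨0, rfl⟩))
        (Submodule.smul_mem _ _ (Submodule.subset_span ⟨1, rfl⟩))
    · exact (finrank_range_le_card (R := ℝ) ![z, ⟨_, hzI⟩]).trans (by simp)
  · refine ⟨⊥, fun z hz => ?_, inferInstance, by rw [finrank_bot]; exact Nat.zero_le _⟩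
    by_contra hzb
    exact hex ⟨z, hz, fun h => hzb (by rw [h]; exact Submodule.zero_mem _)⟩

end Line

/-! ## §4 The registered stub T6b of `Lines/F0_EngineLocalPackets.lean` -/

/-- **Stub T6b of `Lines/F0_EngineLocalPackets.lean`, proved** (body of `StubT6bDegOneTypeFinrank` with the Lines-local
bundle `IsCohUnitaryIrrep` replaced by its two used fields `gk`, `irred`): for an irreducible `(𝔤, K)`-module of
`U(2,1)` every `H¹_δ` is finite-dimensional of real dimension `≤ 2` (`dim_ℂ ≤ 1`).
[cite: BorelWallach2000, VI Thm. 4.11 (3); Rogawski1990, Prop. 15.2.1 (b)] -/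
theorem stubT6b_holds :
    ∀ (V : Type) [AddCommGroup V] [Module ℂ V]
      (ρK : Representation ℂ (uFormGroup (Fin 2) (Fin 1)).maximalCompact V)
      (ρ𝔤 : (uFormGroup (Fin 2) (Fin 1)).lie →ₗ⁅ℝ⁆ Module.End ℂ V)
      (hGK : IsGKModule (uFormGroup (Fin 2) (Fin 1)) ρK ρ𝔤) (hirr : IsIrreducibleGK ρK ρ𝔤) (δ : ℤ),
      Module.Finite ℝ ↥(upqTypeClasses ρK ρ𝔤 hGK.ad_compat 1 δ) ∧
        Module.finrank ℝ ↥(upqTypeClasses ρK ρ𝔤 hGK.ad_compat 1 δ) ≤ 2 :=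
  fun _ _ _ ρK ρ𝔤 hGK hirr δ => typeClasses_finite_finrank_le_two ρK ρ𝔤 hGK.ad_compat hirr δ

end Summit.HodgeConjecture.HodgeConjecture.Cruxes.H413.F0P3bStubT6bDegOneTypeFinrank

end
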